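import Summits.ResolutionOfSingularities.ResolutionOfSingularities.Theorems.SubmaximalShadowKernels
import Summits.ResolutionOfSingularities.ResolutionOfSingularities.Theorems.PrincipalAxisCut
import Literature.AlgebraicGeometry.Resolution.PowerSeriesRegularLocal
import HarnessLib

/-!
# Submaximal shadow cut — CARVES, ROOT, WITNESS (lens-4 g46, node «SubmaximalCut», slice S5)

§1 THE EXACT CARVES (zero binders, genuine `↔`): of the door letter
`surfaceLawAll_iff_g46 : MaxContactCut.SurfaceLawAll ↔ DeepSurfaceLawAll`, and of the binder that REMAINS in the root,
`contactHuggingTowersTerminate_iff_g46 (n) : ContactHuggingTowersTerminate n ↔ NoTower n SubmaximalSurfaceHugging ∧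
NoTower n (fun T => ContactHugging T ∧ ¬ SubmaximalSurfaceHugging T)`, sharpened by LAW E to
`noContactHuggingTowers_iff_g46 : MaxContactCut.NoContactHuggingTowers ↔ DeepContactLawAll`.
§2 THE ROOT `noForcedTowers_of_g46`: g45's `noForcedTowers_of_g45` (Theorems/CurveBranchRoot45, 13 binders) with binder 2
`hSL : MaxContactCut.SurfaceLawAll` DELETED — it is implied by binder `h71` (`surfaceLawAll_of_noContactHuggingTowers`,
dominance RegS ⇒ Contact); the other 12 binders VERBATIM in order, none re-typed, none added; twins `_residual`,
`ftt_step_of_g46`, `forcedTowersTerminate_of_g46`; and, composed with the root LANDED meanwhile (lens-5 «PrincipalAxisCut»,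
`noForcedTowers_of_g47`, 10 binders, Theorems/PrincipalAxisCut), `noForcedTowers_of_g48` = g47 minus exactly `hSL` (9 binders) with
its twins (at 0, letter 238n).  NOT a proof of `MaxContactCut.NoForcedTowers` (30253) outright.
§3 NON-THINNESS WITNESS at ring level (`submaximalFamily_levelShadow`): in `k⟦u₁,u₂,s,t⟧`, for every `n ≥ 2`, `m`,
the germ `f = s·u₁^(n-1) + t^m·u₂^(n-1) + u₂^n` lies in `𝔭^(n-1)`, `𝔭 = (u₁,u₂)` a regular-surface prime, and its
level-`(n-1)` shadow is EXACTLY `(u₁, u₂, s, t^m)` (Loewy length `m`): the submaximal cell of LAW E is inhabited with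
unbounded descent length (tower packaging / isolation of `Top` = desk, NODE-g46 §4).
§4 FQ controls. [cite: Hironaka1964, Ch. III §3; Matsumura1987, Thm. 14.2, §16; CossartJannsenSaito2009, Thm. 5.31]
-/

noncomputable section

set_option linter.dupNamespace false

open CategoryTheory CategoryTheory.Limits AlgebraicGeometry TopologicalSpace IsLocalRing
open Literature.AlgebraicGeometry.Resolution Scheme.IdealSheafData
open Summit.ResolutionOfSingularities.ResolutionOfSingularities.Theorems
open WeakOrderReduction ForcedTowerClasses DivergentTowerClasses MonomialTowerClasses
open HugDimensionClasses HugDimensionKernels SurfaceShadowClasses SurfaceShadowKernels AbsoluteContactClasses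

namespace Summit.ResolutionOfSingularities.ResolutionOfSingularities.Theorems.HugValuationCut

universe u

variable {k : Type} [Field k]

open Summit.ResolutionOfSingularities.ResolutionOfSingularities.Theses

/-! ## §1 The exact carves (zero binders) -/

/-- **CARVE of the door letter (registry of item 32262)**: `SurfaceLawAll ⟺ DeepSurfaceLawAll` — the submaximal cell is
DECIDED by LAW E, the deep cell is the exact located residual. [folklore] -/
theorem surfaceLawAll_iff_g46 : MaxContactCut.SurfaceLawAll ↔ DeepSurfaceLawAll := by
  refine ⟨fun h n hn => (regularSurfaceHuggingTowersTerminate_iff_cells.mp (surfaceLaw_iff_noTower.mp (h n hn))).2,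
    fun h n hn => surfaceLaw_iff_noTower.mpr ?_⟩
  exact regularSurfaceHuggingTowersTerminate_iff_cells.mpr ⟨noTower_submaximalSurfaceHugging hn, h n hn⟩

/-- **CARVE of the REMAINING root binder's letter** (weight `n`, hypothesis-free partition):
`ContactHuggingTowersTerminate n ⟺ NoTower n SubmaximalSurfaceHugging ∧ NoTower n (Contact ∧ ¬ Submaximal)`. [folklore] -/
theorem contactHuggingTowersTerminate_iff_g46 (n : ℕ) :
    ContactHuggingTowersTerminate n ↔
      NoTower n SubmaximalSurfaceHugging ∧ NoTower n (fun T => ContactHugging T ∧ ¬ SubmaximalSurfaceHugging T) :=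
  contactHuggingTowersTerminate_iff_cells

/-- **the contact column minus its DECIDED submaximal cell** (weight `n ≥ 1`, by LAW E):
`ContactHuggingTowersTerminate n ⟺ DeepContactLaw n`. [folklore] -/
theorem contactHuggingTowersTerminate_iff_deepContactLaw {n : ℕ} (hn : 1 ≤ n) :
    ContactHuggingTowersTerminate n ↔ DeepContactLaw n :=
  ⟨fun h => (contactHuggingTowersTerminate_iff_cells.mp h).2,
    fun h => contactHuggingTowersTerminate_iff_cells.mpr ⟨noTower_submaximalSurfaceHugging hn, h⟩⟩

/-- **CARVE of binder `h71` at the `All` level (registry of item 31571)**: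
`MaxContactCut.NoContactHuggingTowers ⟺ DeepContactLawAll`. [folklore] -/
theorem noContactHuggingTowers_iff_g46 : MaxContactCut.NoContactHuggingTowers ↔ DeepContactLawAll :=
  ⟨fun h n hn => (contactHuggingTowersTerminate_iff_deepContactLaw hn).mp (h n hn),
    fun h n hn => (contactHuggingTowersTerminate_iff_deepContactLaw hn).mpr (h n hn)⟩

/-! ## §2 The root with `hSL` shed (12 binders = g45's 13 minus exactly `hSL`) -/

section SubmaximalCutRoot

/-- **the weight-`n` step from the g46 cells**: g45's `ftt_step_of_g45` with `hSL := surfaceLaw_of_contactHuggingTowersTerminate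
h71`; nothing else changed. [folklore] -/
theorem ftt_step_of_g46 {n : ℕ} (hn : 1 ≤ n) (hMo : MonomialCorner n)
    (hH : HypersurfaceHuggingTowersTerminate n) (hP : ShadowPort n) (hM : MarkingPort n)
    (hRi : RiderPort n) (h71 : ContactHuggingTowersTerminate n)
    (hB : WildLatentFactorNonThreefoldMixedWallFreeFreshJumpShallowCompanionKangarooTowersTerminate n)
    (hC4 : WildOccultDivisorialNonThreefoldMixedWallFreeFreshJumpShallowCompanionKangarooTowersTerminate n)
    (hD4 : WildOccultNonDivisorialNonThreefoldMixedWallFreeFreshJumpShallowCompanionKangarooTowersTerminate n)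
    (hNP : ContactFreeNonPrincipalInLocusTowersTerminate n) (hPu : PurePrincipalTowersTerminate n)
    (hR : IncommensurableWildDriftingImperfectTowersTerminate n)
    (hlow : ∀ n' : ℕ, 1 ≤ n' → n' < n → ForcedTowersTerminate n') : ForcedTowersTerminate n :=
  ftt_step_of_g45 hn hMo (surfaceLaw_of_contactHuggingTowersTerminate h71) hH hP hM hRi h71 hB hC4 hD4 hNP hPu hR hlow

/-- **`∀ n ≥ 1, ForcedTowersTerminate n`** from the g46 cells (`hSL` shed). [folklore] -/
theorem forcedTowersTerminate_of_g46 (hMo : MaxContactCut.MonomialCornerAll)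
    (hH : MaxContactCut.NoHypersurfaceHuggingTowers) (hP : ShadowPortAll)
    (hM : MarkingPortAll) (hRi : RiderPortAll) (h71 : MaxContactCut.NoContactHuggingTowers)
    (hB : NoWildLatentFactorNonThreefoldMixedTowers)
    (hC4 : NoWildOccultDivisorialNonThreefoldMixedTowers) (hD4 : NoWildOccultNonDivisorialNonThreefoldMixedTowers)
    (hNP : NoContactFreeNonPrincipalInLocusTowers) (hPu : NoPurePrincipalTowers) (hR : NoIncommensurableWildDriftingImperfectTowers) :
    ∀ n : ℕ, 1 ≤ n → ForcedTowersTerminate n :=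
  forcedTowersTerminate_of_g45 hMo (surfaceLawAll_of_noContactHuggingTowers h71) hH hP hM hRi h71 hB hC4 hD4 hNP hPu hR

/-- **30253 `MaxContactCut.NoForcedTowers` BY NAME from the g46 cells: g45's root consumer `noForcedTowers_of_g45` with
binder 2 `hSL : MaxContactCut.SurfaceLawAll` SHED — supplied by the theorem `surfaceLawAll_of_noContactHuggingTowers h71`
(a tower hugging a regular surface germ has permanent contact with it); the other 12 binders verbatim.**  NOT a proof of
`MaxContactCut.NoForcedTowers` outright: `hMo hP hM hRi` (structural), `hH h71` (hugging columns; `h71 ⟺ DeepContactLawAll`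
by `noContactHuggingTowers_iff_g46`), `hB hC4 hD4` (non-threefold mixed cells) and `hNP hPu hR` (leaves) remain hypotheses.
[folklore] -/
theorem noForcedTowers_of_g46 (hMo : MaxContactCut.MonomialCornerAll)
    (hH : MaxContactCut.NoHypersurfaceHuggingTowers) (hP : ShadowPortAll)
    (hM : MarkingPortAll) (hRi : RiderPortAll) (h71 : MaxContactCut.NoContactHuggingTowers)
    (hB : NoWildLatentFactorNonThreefoldMixedTowers)
    (hC4 : NoWildOccultDivisorialNonThreefoldMixedTowers) (hD4 : NoWildOccultNonDivisorialNonThreefoldMixedTowers)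
    (hNP : NoContactFreeNonPrincipalInLocusTowers) (hPu : NoPurePrincipalTowers) (hR : NoIncommensurableWildDriftingImperfectTowers) :
    MaxContactCut.NoForcedTowers :=
  noForcedTowers_of_g45 hMo (surfaceLawAll_of_noContactHuggingTowers h71) hH hP hM hRi h71 hB hC4 hD4 hNP hPu hR

/-- the same from the ABSOLUTE g43 located residual `NoWildOccultNonThreefoldMixedTowers` by name (11 binders). [folklore] -/
theorem noForcedTowers_of_g46_residual (hMo : MaxContactCut.MonomialCornerAll)
    (hH : MaxContactCut.NoHypersurfaceHuggingTowers) (hP : ShadowPortAll)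
    (hM : MarkingPortAll) (hRi : RiderPortAll) (h71 : MaxContactCut.NoContactHuggingTowers)
    (hB : NoWildLatentFactorNonThreefoldMixedTowers) (hres : NoWildOccultNonThreefoldMixedTowers)
    (hNP : NoContactFreeNonPrincipalInLocusTowers) (hPu : NoPurePrincipalTowers) (hR : NoIncommensurableWildDriftingImperfectTowers) :
    MaxContactCut.NoForcedTowers :=
  noForcedTowers_of_g46 hMo hH hP hM hRi h71 hB hres.1 hres.2 hNP hPu hR

/-! ### §2b Composition with the root landed meanwhile: `noForcedTowers_of_g47` (Theorems/PrincipalAxisCut, 10 binders) minus `hSL` -/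

/-- **the weight-`n` step from the g48 cells**: `ftt_step_of_g47` with `hSL := surfaceLaw_of_contactHuggingTowersTerminate h71`.
[folklore] -/
theorem ftt_step_of_g48 {n : ℕ} (hn : 1 ≤ n) (hMo : MonomialCorner n)
    (hH : HypersurfaceHuggingTowersTerminate n) (hP : ShadowPort n) (hM : MarkingPort n)
    (h71 : ContactHuggingTowersTerminate n)
    (hB : WildLatentFactorNonThreefoldMixedWallFreeFreshJumpShallowCompanionKangarooTowersTerminate n)
    (hC4 : WildOccultDivisorialNonThreefoldMixedWallFreeFreshJumpShallowCompanionKangarooTowersTerminate n)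
    (hD4 : WildOccultNonDivisorialNonThreefoldMixedWallFreeFreshJumpShallowCompanionKangarooTowersTerminate n)
    (hNP : ContactFreeNonPrincipalInLocusTowersTerminate n)
    (hlow : ∀ n' : ℕ, 1 ≤ n' → n' < n → ForcedTowersTerminate n') : ForcedTowersTerminate n :=
  ftt_step_of_g47 hn hMo (surfaceLaw_of_contactHuggingTowersTerminate h71) hH hP hM h71 hB hC4 hD4 hNP hlow

/-- **`∀ n ≥ 1, ForcedTowersTerminate n`** from the g48 cells (`hSL` shed from `forcedTowersTerminate_of_g47`). [folklore] -/
theorem forcedTowersTerminate_of_g48 (hMo : MaxContactCut.MonomialCornerAll)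
    (hH : MaxContactCut.NoHypersurfaceHuggingTowers) (hP : ShadowPortAll)
    (hM : MarkingPortAll) (h71 : MaxContactCut.NoContactHuggingTowers)
    (hB : NoWildLatentFactorNonThreefoldMixedTowers)
    (hC4 : NoWildOccultDivisorialNonThreefoldMixedTowers) (hD4 : NoWildOccultNonDivisorialNonThreefoldMixedTowers)
    (hNP : NoContactFreeNonPrincipalInLocusTowers) :
    ∀ n : ℕ, 1 ≤ n → ForcedTowersTerminate n :=
  forcedTowersTerminate_of_g47 hMo (surfaceLawAll_of_noContactHuggingTowers h71) hH hP hM h71 hB hC4 hD4 hNP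

/-- **30253 `MaxContactCut.NoForcedTowers` BY NAME from NINE binders: the landed root `noForcedTowers_of_g47` (lens-5
«PrincipalAxisCut», 10 binders) with binder 2 `hSL : MaxContactCut.SurfaceLawAll` SHED by `surfaceLawAll_of_noContactHuggingTowers
h71`; the other nine verbatim.**  NOT a proof outright: `hMo hP hM`, `hH h71`, `hB hC4 hD4`, `hNP` remain hypotheses. [folklore] -/
theorem noForcedTowers_of_g48 (hMo : MaxContactCut.MonomialCornerAll)
    (hH : MaxContactCut.NoHypersurfaceHuggingTowers) (hP : ShadowPortAll)
    (hM : MarkingPortAll) (h71 : MaxContactCut.NoContactHuggingTowers)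
    (hB : NoWildLatentFactorNonThreefoldMixedTowers)
    (hC4 : NoWildOccultDivisorialNonThreefoldMixedTowers) (hD4 : NoWildOccultNonDivisorialNonThreefoldMixedTowers)
    (hNP : NoContactFreeNonPrincipalInLocusTowers) :
    MaxContactCut.NoForcedTowers :=
  noForcedTowers_of_g47 hMo (surfaceLawAll_of_noContactHuggingTowers h71) hH hP hM h71 hB hC4 hD4 hNP

/-- the same from the ABSOLUTE g43 located residual `NoWildOccultNonThreefoldMixedTowers` by name (eight binders). [folklore] -/
theorem noForcedTowers_of_g48_residual (hMo : MaxContactCut.MonomialCornerAll)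
    (hH : MaxContactCut.NoHypersurfaceHuggingTowers) (hP : ShadowPortAll)
    (hM : MarkingPortAll) (h71 : MaxContactCut.NoContactHuggingTowers)
    (hB : NoWildLatentFactorNonThreefoldMixedTowers) (hres : NoWildOccultNonThreefoldMixedTowers)
    (hNP : NoContactFreeNonPrincipalInLocusTowers) :
    MaxContactCut.NoForcedTowers :=
  noForcedTowers_of_g48 hMo hH hP hM h71 hB hres.1 hres.2 hNP

end SubmaximalCutRoot

/-! ## §3 The submaximal cell is inhabited: the family `s·u₁^(n-1) + t^m·u₂^(n-1) + u₂^n` at ring level -/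

section Witness

open MvPolynomial

/-- **NON-THINNESS WITNESS (§4 family, ring level).**  In `R = k⟦X₀,X₁,X₂,X₃⟧` (`u₁ = X₀, u₂ = X₁, s = X₂, t = X₃`) put
`u = (X₀, X₁)`, `𝔭 = (u)`, `f = X₂·X₀^(n-1) + X₃^m·X₁^(n-1) + X₁^n` (`n ≥ 2`).  Then `u` is part of a regular system of
parameters with `R/𝔭` regular of dimension `2` (a regular SURFACE germ), `(f) ⊆ 𝔭^(n-1)` (SUBMAXIMAL contact), and
the level-`(n-1)` shadow of `(f)` along `𝔭` is EXACTLY `(X₀, X₁, X₂, X₃^m)` — of Loewy length `m`, unbounded in the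
family. [cite: Matsumura1987, Thm. 14.2, §16] -/
theorem submaximalFamily_levelShadow (k : Type) [Field k] {n : ℕ} (hn : 2 ≤ n) (m : ℕ) :
    IsRsopPart (fun i : Fin 2 => (MvPowerSeries.X (Fin.castAdd 2 i) : MvPowerSeries (Fin 4) k)) ∧
    IsRegularLocalRing (MvPowerSeries (Fin 4) k ⧸
      Ideal.span (Set.range fun i : Fin 2 => (MvPowerSeries.X (Fin.castAdd 2 i) : MvPowerSeries (Fin 4) k))) ∧
    ringKrullDim (MvPowerSeries (Fin 4) k ⧸
      Ideal.span (Set.range fun i : Fin 2 => (MvPowerSeries.X (Fin.castAdd 2 i) : MvPowerSeries (Fin 4) k))) = 2 ∧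
    Ideal.span {(MvPowerSeries.X 2 * MvPowerSeries.X 0 ^ (n - 1) + MvPowerSeries.X 3 ^ m * MvPowerSeries.X 1 ^ (n - 1) +
        MvPowerSeries.X 1 ^ n : MvPowerSeries (Fin 4) k)} ≤
      Ideal.span (Set.range fun i : Fin 2 => (MvPowerSeries.X (Fin.castAdd 2 i) : MvPowerSeries (Fin 4) k)) ^ (n - 1) ∧
    levelShadow (Ideal.span (Set.range fun i : Fin 2 => (MvPowerSeries.X (Fin.castAdd 2 i) : MvPowerSeries (Fin 4) k)))
        (Ideal.span {(MvPowerSeries.X 2 * MvPowerSeries.X 0 ^ (n - 1) + MvPowerSeries.X 3 ^ m * MvPowerSeries.X 1 ^ (n - 1) +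
          MvPowerSeries.X 1 ^ n : MvPowerSeries (Fin 4) k)}) (n - 1) =
      Ideal.span {MvPowerSeries.X 0, MvPowerSeries.X 1, MvPowerSeries.X 2, MvPowerSeries.X 3 ^ m} := by
  obtain ⟨n, rfl⟩ := Nat.exists_eq_add_of_le' hn
  have h21 : n + 2 - 1 = n + 1 := rfl
  rw [h21]
  set u : Fin 2 → MvPowerSeries (Fin 4) k := fun i => MvPowerSeries.X (Fin.castAdd 2 i) with hudef
  set f : MvPowerSeries (Fin 4) k := MvPowerSeries.X 2 * MvPowerSeries.X 0 ^ (n + 1) +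
    MvPowerSeries.X 3 ^ m * MvPowerSeries.X 1 ^ (n + 1) + MvPowerSeries.X 1 ^ (n + 2) with hfdef
  have hu : IsRsopPart u := by
    have h := (isRsopPart_X k (Fin 4) (Equiv.refl _)).comp (Fin.castAdd 2) (Fin.castAdd_injective _ _)
    exact h
  have hu0 : u 0 = MvPowerSeries.X 0 := rfl
  have hu1 : u 1 = MvPowerSeries.X 1 := rfl
  have hX0 : (MvPowerSeries.X 0 : MvPowerSeries (Fin 4) k) ∈ Ideal.span (Set.range u) := hu0 ▸ Ideal.subset_span ⟨0, rfl⟩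
  have hX1 : (MvPowerSeries.X 1 : MvPowerSeries (Fin 4) k) ∈ Ideal.span (Set.range u) := hu1 ▸ Ideal.subset_span ⟨1, rfl⟩
  -- the regular surface `R/𝔭`
  have hdim : ringKrullDim (MvPowerSeries (Fin 4) k ⧸ Ideal.span (Set.range u)) = 2 := by
    have h := hu.ringKrullDim_quotient_add
    rw [ringKrullDim_mvPowerSeries, Nat.card_fin] at h
    exact_mod_cast withBot_eNat_add_natCast_cancel (a := 2) (b := 2) (by exact_mod_cast h)
  -- submaximality `(f) ⊆ 𝔭^(n+1)`
  have hX1pow : (MvPowerSeries.X 1 : MvPowerSeries (Fin 4) k) ^ (n + 2) =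
      MvPowerSeries.X 1 * MvPowerSeries.X 1 ^ (n + 1) := pow_succ' _ _
  have hsub : Ideal.span {f} ≤ Ideal.span (Set.range u) ^ (n + 1) := by
    rw [Ideal.span_singleton_le_iff_mem, hfdef]
    refine add_mem (add_mem (Ideal.mul_mem_left _ _ (Ideal.pow_mem_pow hX0 _))
      (Ideal.mul_mem_left _ _ (Ideal.pow_mem_pow hX1 _))) ?_
    rw [hX1pow]
    exact Ideal.mul_mem_left _ _ (Ideal.pow_mem_pow hX1 _)
  refine ⟨hu, hu.isRegularLocalRing_quotient, hdim, hsub, le_antisymm (levelShadow_le ?_ ?_) ?_⟩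
  · -- `𝔭 ⊆ 𝔞₀`
    rw [Ideal.span_le]
    rintro _ ⟨i, rfl⟩
    fin_cases i
    · exact Ideal.subset_span (by simp [hudef])
    · exact Ideal.subset_span (by simp [hudef])
  · -- `(f) ⊆ 𝔞₀ · 𝔭^(n+1)`
    rw [Ideal.span_singleton_le_iff_mem, hfdef]
    refine add_mem (add_mem (Ideal.mul_mem_mul (Ideal.subset_span (by simp)) (Ideal.pow_mem_pow hX0 _))
      (Ideal.mul_mem_mul (Ideal.subset_span (by simp)) (Ideal.pow_mem_pow hX1 _))) ?_
    rw [hX1pow]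
    exact Ideal.mul_mem_mul (Ideal.subset_span (by simp)) (Ideal.pow_mem_pow hX1 _)
  · -- `𝔞₀ ⊆ 𝔍`: `X₀, X₁ ∈ 𝔭 ⊆ 𝔍`; `X₂` and `X₃^m + X₁` are the coefficients of the degree-`(n+1)` form
    -- `F = X₂·Y₀^(n+1) + (X₃^m + X₁)·Y₁^(n+1)` with `F(u) = f` (quasi-regular coefficient criterion)
    have h𝔭𝔍 := le_levelShadow (Ideal.span (Set.range u)) (Ideal.span {f}) (n + 1)
    set F : MvPolynomial (Fin 2) (MvPowerSeries (Fin 4) k) :=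
      monomial (Finsupp.single 0 (n + 1)) (MvPowerSeries.X 2) +
        monomial (Finsupp.single 1 (n + 1)) (MvPowerSeries.X 3 ^ m + MvPowerSeries.X 1) with hFdef
    have hdeg : ∀ i : Fin 2, (Finsupp.single i (n + 1)).degree = n + 1 := fun i => by
      rw [Finsupp.degree_single]
    have hF : F.IsHomogeneous (n + 1) :=
      (isHomogeneous_monomial _ (hdeg 0)).add (isHomogeneous_monomial _ (hdeg 1))
    have hFu : eval u F = f := by
      rw [hFdef, map_add, eval_monomial, eval_monomial, Finsupp.prod_single_index (by rw [pow_zero]),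
        Finsupp.prod_single_index (by rw [pow_zero]), hu0, hu1, hfdef]
      ring
    have hne : Finsupp.single (0 : Fin 2) (n + 1) ≠ Finsupp.single 1 (n + 1) :=
      (Finsupp.single_left_injective (Nat.succ_ne_zero n)).ne (by decide)
    have hcoef := coeff_mem_levelShadow hu.isQuasiRegular hsub hF (by rw [hFu]; exact Ideal.mem_span_singleton_self f)
    have h2 : (MvPowerSeries.X 2 : MvPowerSeries (Fin 4) k) ∈ levelShadow (Ideal.span (Set.range u)) (Ideal.span {f}) (n + 1) := by
      have h := hcoef (Finsupp.single 0 (n + 1))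
      rwa [hFdef, coeff_add, coeff_monomial, coeff_monomial, if_pos rfl, if_neg hne.symm, add_zero] at h
    have h3 : (MvPowerSeries.X 3 ^ m : MvPowerSeries (Fin 4) k) ∈ levelShadow (Ideal.span (Set.range u)) (Ideal.span {f}) (n + 1) := by
      have h := hcoef (Finsupp.single 1 (n + 1))
      rw [hFdef, coeff_add, coeff_monomial, coeff_monomial, if_neg hne, if_pos rfl, zero_add] at h
      exact (Submodule.add_mem_iff_left _ (h𝔭𝔍 hX1)).mp h
    rw [Ideal.span_le]
    rintro x hx
    simp only [Set.mem_insert_iff, Set.mem_singleton_iff] at hx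
    rcases hx with rfl | rfl | rfl | rfl
    · exact h𝔭𝔍 hX0
    · exact h𝔭𝔍 hX1
    · exact h2
    · exact h3

/-- the Loewy bound read off the witness: `𝔪^m ⊆ 𝔍` for the shadow `𝔍 = (X₀, X₁, X₂, X₃^m)`. [cite: Matsumura1987, §16] -/
theorem maximalIdeal_pow_le_submaximalFamily_shadow (k : Type) [Field k] (m : ℕ) :
    maximalIdeal (MvPowerSeries (Fin 4) k) ^ m ≤
      Ideal.span {MvPowerSeries.X 0, MvPowerSeries.X 1, MvPowerSeries.X 2, MvPowerSeries.X 3 ^ m} := by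
  have h𝔪 : maximalIdeal (MvPowerSeries (Fin 4) k) ≤
      Ideal.span {MvPowerSeries.X 3} ⊔ Ideal.span {MvPowerSeries.X 0, MvPowerSeries.X 1, MvPowerSeries.X 2} := by
    rw [maximalIdeal_mvPowerSeries_eq_span, Ideal.span_le]
    rintro _ ⟨i, rfl⟩
    fin_cases i
    · exact Ideal.mem_sup_right (Ideal.subset_span (by simp))
    · exact Ideal.mem_sup_right (Ideal.subset_span (by simp))
    · exact Ideal.mem_sup_right (Ideal.subset_span (by simp))
    · exact Ideal.mem_sup_left (Ideal.mem_span_singleton_self _)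
  refine (Ideal.pow_right_mono h𝔪 m).trans ((sup_pow_le_pow_sup _ _ m).trans ?_)
  rw [Ideal.span_singleton_pow]
  refine sup_le ?_ ?_
  · rw [Ideal.span_singleton_le_iff_mem]; exact Ideal.subset_span (by simp)
  · exact Ideal.span_mono (by intro x hx; simp only [Set.mem_insert_iff, Set.mem_singleton_iff] at hx ⊢; tauto)

end Witness

/-! ## §4 FQ controls (the statements BY NAME, proved by the theorems above) -/

example : ∀ {n : ℕ}, 1 ≤ n →
    Summit.ResolutionOfSingularities.ResolutionOfSingularities.Theorems.DivergentTowerClasses.NoTower n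
      Summit.ResolutionOfSingularities.ResolutionOfSingularities.Theorems.HugValuationCut.SubmaximalSurfaceHugging :=
  fun hn => noTower_submaximalSurfaceHugging hn

example : Summit.ResolutionOfSingularities.ResolutionOfSingularities.Theses.MaxContactCut.SurfaceLawAll ↔
    Summit.ResolutionOfSingularities.ResolutionOfSingularities.Theorems.HugValuationCut.DeepSurfaceLawAll :=
  surfaceLawAll_iff_g46

example : Summit.ResolutionOfSingularities.ResolutionOfSingularities.Theses.MaxContactCut.NoContactHuggingTowers ↔
    Summit.ResolutionOfSingularities.ResolutionOfSingularities.Theorems.HugValuationCut.DeepContactLawAll :=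
  noContactHuggingTowers_iff_g46

example : Summit.ResolutionOfSingularities.ResolutionOfSingularities.Theorems.SurfaceShadowClasses.SurfaceLaw 1 :=
  surfaceLaw_one

example (hMo : Summit.ResolutionOfSingularities.ResolutionOfSingularities.Theses.MaxContactCut.MonomialCornerAll)
    (hH : Summit.ResolutionOfSingularities.ResolutionOfSingularities.Theses.MaxContactCut.NoHypersurfaceHuggingTowers)
    (hP : ShadowPortAll) (hM : MarkingPortAll) (hRi : RiderPortAll)
    (h71 : Summit.ResolutionOfSingularities.ResolutionOfSingularities.Theses.MaxContactCut.NoContactHuggingTowers)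
    (hB : NoWildLatentFactorNonThreefoldMixedTowers)
    (hC4 : NoWildOccultDivisorialNonThreefoldMixedTowers) (hD4 : NoWildOccultNonDivisorialNonThreefoldMixedTowers)
    (hNP : NoContactFreeNonPrincipalInLocusTowers) (hPu : NoPurePrincipalTowers)
    (hR : NoIncommensurableWildDriftingImperfectTowers) :
    Summit.ResolutionOfSingularities.ResolutionOfSingularities.Theses.MaxContactCut.NoForcedTowers :=
  noForcedTowers_of_g46 hMo hH hP hM hRi h71 hB hC4 hD4 hNP hPu hR

example (hMo : Summit.ResolutionOfSingularities.ResolutionOfSingularities.Theses.MaxContactCut.MonomialCornerAll)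
    (hH : Summit.ResolutionOfSingularities.ResolutionOfSingularities.Theses.MaxContactCut.NoHypersurfaceHuggingTowers)
    (hP : ShadowPortAll) (hM : MarkingPortAll)
    (h71 : Summit.ResolutionOfSingularities.ResolutionOfSingularities.Theses.MaxContactCut.NoContactHuggingTowers)
    (hB : NoWildLatentFactorNonThreefoldMixedTowers)
    (hC4 : NoWildOccultDivisorialNonThreefoldMixedTowers) (hD4 : NoWildOccultNonDivisorialNonThreefoldMixedTowers)
    (hNP : NoContactFreeNonPrincipalInLocusTowers) :
    Summit.ResolutionOfSingularities.ResolutionOfSingularities.Theses.MaxContactCut.NoForcedTowers :=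
  noForcedTowers_of_g48 hMo hH hP hM h71 hB hC4 hD4 hNP

end Summit.ResolutionOfSingularities.ResolutionOfSingularities.Theorems.HugValuationCut
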